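import Mathlib
import Literature.Analysis.FluidPDE.VectorCalculus
import Summits.NavierStokesRegularity.NavierStokesRegularity.Theses.UnthreadedRigidityDoor
import Summits.NavierStokesRegularity.NavierStokesRegularity.Theorems.ThreadingFluxCentreJetDefs
import Summits.NavierStokesRegularity.NavierStokesRegularity.Theorems.ThreadingFluxPlatonicDefs
import Summits.NavierStokesRegularity.NavierStokesRegularity.Theorems.ThreadingFluxPlatonicSymmetryAlgebra
import Summits.NavierStokesRegularity.NavierStokesRegularity.Theorems.ThreadingFluxPlatonicAncientOseen
import Summits.NavierStokesRegularity.NavierStokesRegularity.Theorems.ThreadingFluxPlatonicWindowGlueIsometries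
import HarnessLib

/-!
# Crux `PoloidalLiouville` (stmt-NavierStokesRegularity-1222, W1) / `UnthreadedRigidity` (stmt-…-27585, W2), crux idea «platonic-germ-sieve»
# (ns-idea-15 g11, V27): the SMALLEST platonic class — two generators of the tetrahedral rotation group

Support file (Theorems-side; seat ns-wall-eng-8 g8, cell `ns-wall-extremal`; `--supports stmt-NavierStokesRegularity-1222 --as helper`; 0 kit).
The class-free wiring `Platonic.symmetricPoloidalLiouville_of_unthreadedRigidity_of_isometries` (`ThreadingFluxPlatonicWindowGlueIsometries.lean`)
needs only a SET of linear isometries preserving no axis.  The smallest such set drawn from the rotations of the cube has TWO elements: the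
half-turn `h₀ : (x₀, x₁, x₂) ↦ (x₀, −x₁, −x₂)` and the coordinate 3-cycle `r : (x₀, x₁, x₂) ↦ (x₁, x₂, x₀)`; they generate the tetrahedral
rotation group `T` (order 12, index 2 in O), the smallest finite subgroup of `SO(3)` acting irreducibly on `ℝ³`.  Equivariance under
`{h₀, r}` is equivariance under `T` — strictly WEAKER than the O-equivariance of the card's typed Prop `SymmetricPoloidalLiouville octahedral`,
so the statements below are strictly STRONGER instances of W1|_G ⇐ ⟨27585⟩:

* `Platonic.preservesNoAxis_tetraGen : PreservesNoAxis tetraGen-set` — `{h₀, r}` preserves no axis (`r a ∥ a` forces `a₀ = a₁ = a₂`, and then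
  `h₀ a ∦ a`);
* ★ `Platonic.symmetricWindowRigidity_tetraGen_of_unthreadedRigidity`, ★★ `Platonic.symmetricPoloidalLiouville_tetraGen_of_unthreadedRigidity`,
  ★ `Platonic.symmetricSteadyLiouville_tetraGen_of_unthreadedRigidity` — the window statement, W1 restricted to the `{h₀, r}`-equivariant
  (= T-equivariant) class, and its steady stratum, from ⟨27585⟩ BY NAME;
* `Platonic.isEquivariant_mono` / `symmetricPoloidalLiouville_mono` / `symmetricWindowRigidity_mono` / `symmetricSteadyLiouville_mono` —
  the three typed Props are MONOTONE in the class (`G ⊆ G'` ⇒ statement for `G` implies statement for `G'`), and `{h₀, r} ⊆ octahedral`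
  (`tetraGen_subset_octahedral`), so the octahedral statements are corollaries of the two-generator ones
  (`symmetricPoloidalLiouville_octahedral_of_tetraGen`);
* negation home `Platonic.not_unthreadedRigidity_of_symmetricCounterexample_tetraGen`.

The set is written `{cubeRot 1 ![1, -1, -1], cubeRot (finRotate 3) (fun _ => 1)}` throughout (no new definition).

HONEST LABEL: conditional glue strictly below W1/W2 (hypothesis ⟨27585⟩); `OctahedralCentreRigidity`, ⟨1222⟩, ⟨27585⟩ and NS regularity are OPEN
and NOT touched; information-grade (movement 0).

## References
* G. Koch, N. Nadirashvili, G. Seregin, V. Šverák, Acta Math. 203 (2009) 83–105, arXiv:0709.3599.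
* L. Brandolese, Math. Ann. 329 (2004) 685–706, arXiv:math/0304436 (polyhedral symmetry classes of NS flows).
-/

-- the summit and its single sub-problem share the name (CONVENTIONS §1)
set_option linter.dupNamespace false

noncomputable section

open Set Function Filter Metric MeasureTheory Module
open scoped RealInnerProductSpace Topology
open Literature.Analysis.FluidPDE
open Summit.NavierStokesRegularity.NavierStokesRegularity.Theses
open Summit.NavierStokesRegularity.NavierStokesRegularity.Theorems.PoloidalLiouville.CentreJet (E3)

namespace Summit.NavierStokesRegularity.NavierStokesRegularity.Theorems.PoloidalLiouville.Platonic

/-! ## Monotonicity of the three typed Props in the class -/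

/-- Equivariance under a larger set implies equivariance under a smaller one. -/
theorem isEquivariant_mono {G G' : Set (E3 → E3)} (hGG' : G ⊆ G') {u : E3 → E3} (h : IsEquivariant G' u) : IsEquivariant G u :=
  fun g hg x => h g (hGG' hg) x

/-- `SymmetricPoloidalLiouville` is monotone in the class: the statement for a smaller symmetry set is the stronger one. -/
theorem symmetricPoloidalLiouville_mono {G G' : Set (E3 → E3)} (hGG' : G ⊆ G') (h : SymmetricPoloidalLiouville G) :
    SymmetricPoloidalLiouville G' :=
  fun v hv hmeas hsm hun hequi => h v hv hmeas hsm hun (fun t ht => isEquivariant_mono hGG' (hequi t ht))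

/-- `SymmetricWindowRigidity` is monotone in the class. -/
theorem symmetricWindowRigidity_mono {G G' : Set (E3 → E3)} (hGG' : G ⊆ G') (h : SymmetricWindowRigidity G) :
    SymmetricWindowRigidity G' :=
  fun S hS hpre u hcont hdiv hmild hbdd hun hequi =>
    h S hS hpre u hcont hdiv hmild hbdd hun (fun t ht => isEquivariant_mono hGG' (hequi t ht))

/-- `SymmetricSteadyLiouville` is monotone in the class. -/
theorem symmetricSteadyLiouville_mono {G G' : Set (E3 → E3)} (hGG' : G ⊆ G') (h : SymmetricSteadyLiouville G) :
    SymmetricSteadyLiouville G' :=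
  fun V p hNS hB hun hequi => h V p hNS hB hun (isEquivariant_mono hGG' hequi)

/-! ## The two generators `h₀`, `r` of the tetrahedral rotation group -/

/-- Coordinates of the half-turn `h₀`. -/
theorem cubeRot_halfTurn₀_apply (x : E3) : cubeRot 1 ![1, -1, -1] x = WithLp.toLp 2 ![x 0, -x 1, -x 2] := by
  ext i
  fin_cases i <;> simp [cubeRot]

/-- `{h₀, r} ⊆ O`. -/
theorem tetraGen_subset_octahedral :
    ({cubeRot 1 ![1, -1, -1], cubeRot (finRotate 3) (fun _ => 1)} : Set (E3 → E3)) ⊆ octahedral := by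
  intro g hg
  rcases hg with rfl | rfl
  · exact ⟨1, ![1, -1, -1], isCubeRotationData_halfTurn₀, rfl⟩
  · exact ⟨finRotate 3, fun _ => 1, isCubeRotationData_cycle, rfl⟩

/-- The two generators are linear isometries. -/
theorem tetraGen_isometries : ∀ g ∈ ({cubeRot 1 ![1, -1, -1], cubeRot (finRotate 3) (fun _ => 1)} : Set (E3 → E3)),
    ∃ L : E3 ≃ₗᵢ[ℝ] E3, ∀ x, L x = g x :=
  fun _ hg => exists_linearIsometryEquiv_of_mem_octahedral (tetraGen_subset_octahedral hg)

/-- **`{h₀, r}` preserves no axis.**  If `r a = c • a` then `a₁ = c a₀`, `a₂ = c a₁`, `a₀ = c a₂`, so `a₀ = c³ a₀`; for `a ≠ 0` this forces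
`a₀ ≠ 0`, `c = 1` and `a₀ = a₁ = a₂`, and then `h₀ a = (a₀, −a₀, −a₀)` is not a multiple of `a`. -/
theorem preservesNoAxis_tetraGen :
    PreservesNoAxis ({cubeRot 1 ![1, -1, -1], cubeRot (finRotate 3) (fun _ => 1)} : Set (E3 → E3)) := by
  intro a ha
  by_cases hr : ∃ c : ℝ, cubeRot (finRotate 3) (fun _ => 1) a = c • a
  · -- `r a ∥ a`: then `a₀ = a₁ = a₂ ≠ 0` and the half-turn moves the axis
    obtain ⟨c, hc⟩ := hr
    refine ⟨cubeRot 1 ![1, -1, -1], by simp, fun d hd => ?_⟩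
    rw [cubeRot_cycle_apply] at hc
    rw [cubeRot_halfTurn₀_apply] at hd
    have hc0 := congrArg (fun v : E3 => v 0) hc
    have hc1 := congrArg (fun v : E3 => v 1) hc
    have hc2 := congrArg (fun v : E3 => v 2) hc
    have hd0 := congrArg (fun v : E3 => v 0) hd
    have hd1 := congrArg (fun v : E3 => v 1) hd
    simp at hc0 hc1 hc2 hd0 hd1
    -- hc0 : a 1 = c * a 0, hc1 : a 2 = c * a 1, hc2 : a 0 = c * a 2; hd0 : a 0 = d * a 0, hd1 : -a 1 = d * a 1
    have h0 : a 0 ≠ 0 := by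
      intro h0
      have h1 : a 1 = 0 := by rw [hc0, h0, mul_zero]
      have h2 : a 2 = 0 := by rw [hc1, h1, mul_zero]
      exact ha (by ext i; fin_cases i <;> simp [h0, h1, h2])
    -- `c³ = 1` ⇒ `c = 1`
    have hc3 : (c - 1) * (c ^ 2 + c + 1) * a 0 = 0 := by
      have : a 0 = c * (c * (c * a 0)) := by
        calc a 0 = c * a 2 := hc2
          _ = c * (c * a 1) := by rw [hc1]
          _ = c * (c * (c * a 0)) := by rw [hc0]
      linear_combination (-1 : ℝ) * this
    have hc' : c = 1 := by
      rcases mul_eq_zero.1 hc3 with h | h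
      · rcases mul_eq_zero.1 h with h' | h'
        · linarith
        · nlinarith [sq_nonneg (2 * c + 1)]
      · exact absurd h h0
    -- the half-turn: `d = 1` from the first coordinate, then `a₁ = 0`, contradicting `a₁ = a₀ ≠ 0`
    have hd' : d = 1 := by
      have h1 : (d - 1) * a 0 = 0 := by linear_combination (-1 : ℝ) * hd0
      rcases mul_eq_zero.1 h1 with h | h
      · linarith
      · exact absurd h h0
    rw [hd', one_mul] at hd1
    rw [hc', one_mul] at hc0
    have ha1 : a 1 = 0 := by linarith
    exact h0 (by rw [← hc0, ha1])
  · exact ⟨cubeRot (finRotate 3) (fun _ => 1), by simp, fun c hc => hr ⟨c, hc⟩⟩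

/-! ## ★ The three typed Props for the `{h₀, r}`-class (= the tetrahedral class) from ⟨27585⟩ -/

/-- ★ **The window statement for the `{h₀, r}`-equivariant (= T-equivariant) class from ⟨27585⟩.** -/
theorem symmetricWindowRigidity_tetraGen_of_unthreadedRigidity (h27585 : UnthreadedRigidityDoor.UnthreadedRigidity) :
    SymmetricWindowRigidity ({cubeRot 1 ![1, -1, -1], cubeRot (finRotate 3) (fun _ => 1)} : Set (E3 → E3)) :=
  symmetricWindowRigidity_of_unthreadedRigidity_of_isometries tetraGen_isometries preservesNoAxis_tetraGen h27585

/-- ★★ **W1 restricted to the `{h₀, r}`-equivariant (= tetrahedrally equivariant) class follows from ⟨27585⟩, BY NAME.**  If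
`UnthreadedRigidity` holds, every bounded ancient mild solution (KNSS duality class, `ν = 1`) with a.e.-strongly measurable slices, smooth on
`(−∞,0) × ℝ³`, unthreaded about `0` and equivariant under the half-turn `h₀` and the 3-cycle `r` at every negative time VANISHES on `t < 0`.
This is the strongest platonic instance (T is the smallest subgroup of `SO(3)` irreducible on `ℝ³`); the octahedral statement p725805 (iv)
is its corollary by monotonicity (`symmetricPoloidalLiouville_octahedral_of_tetraGen`).  Conditional on ⟨27585⟩. -/
theorem symmetricPoloidalLiouville_tetraGen_of_unthreadedRigidity (h27585 : UnthreadedRigidityDoor.UnthreadedRigidity) :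
    SymmetricPoloidalLiouville ({cubeRot 1 ![1, -1, -1], cubeRot (finRotate 3) (fun _ => 1)} : Set (E3 → E3)) :=
  symmetricPoloidalLiouville_of_unthreadedRigidity_of_isometries tetraGen_isometries preservesNoAxis_tetraGen h27585

/-- ★ **The steady stratum for the `{h₀, r}`-equivariant class from ⟨27585⟩ alone.** -/
theorem symmetricSteadyLiouville_tetraGen_of_unthreadedRigidity (h27585 : UnthreadedRigidityDoor.UnthreadedRigidity) :
    SymmetricSteadyLiouville ({cubeRot 1 ![1, -1, -1], cubeRot (finRotate 3) (fun _ => 1)} : Set (E3 → E3)) :=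
  symmetricSteadyLiouville_of_unthreadedRigidity_of_isometries tetraGen_isometries preservesNoAxis_tetraGen h27585

/-- **Negation home.**  A bounded ancient mild solution, smooth, unthreaded about `0`, equivariant under `h₀` and `r` only, and non-zero at
some negative time, refutes ⟨27585⟩ — a strictly larger hunting ground than `SymmetricCounterexample octahedral`. -/
theorem not_unthreadedRigidity_of_symmetricCounterexample_tetraGen
    (hc : SymmetricCounterexample ({cubeRot 1 ![1, -1, -1], cubeRot (finRotate 3) (fun _ => 1)} : Set (E3 → E3))) :
    ¬ UnthreadedRigidityDoor.UnthreadedRigidity :=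
  not_unthreadedRigidity_of_symmetricCounterexample_of_isometries tetraGen_isometries preservesNoAxis_tetraGen hc

/-! ## The octahedral statements as corollaries of the two-generator ones -/

/-- Monotonicity instance: the two-generator poloidal Liouville statement implies the octahedral one (`{h₀, r} ⊆ O`). -/
theorem symmetricPoloidalLiouville_octahedral_of_tetraGen
    (h : SymmetricPoloidalLiouville ({cubeRot 1 ![1, -1, -1], cubeRot (finRotate 3) (fun _ => 1)} : Set (E3 → E3))) :
    SymmetricPoloidalLiouville octahedral :=
  symmetricPoloidalLiouville_mono tetraGen_subset_octahedral h

/-- Monotonicity instance on the negation side: an octahedral counterexample is a two-generator counterexample. -/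
theorem symmetricCounterexample_tetraGen_of_octahedral (hc : SymmetricCounterexample octahedral) :
    SymmetricCounterexample ({cubeRot 1 ![1, -1, -1], cubeRot (finRotate 3) (fun _ => 1)} : Set (E3 → E3)) := by
  obtain ⟨v, hv, hmeas, hsm, hun, hequi, t, ht, x, hx⟩ := hc
  exact ⟨v, hv, hmeas, hsm, hun, fun s hs => isEquivariant_mono tetraGen_subset_octahedral (hequi s hs), t, ht, x, hx⟩

end Summit.NavierStokesRegularity.NavierStokesRegularity.Theorems.PoloidalLiouville.Platonic

end
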